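import Mathlib
import HarnessLib
import HarnessLib.Audit
import Summits.BirchSwinnertonDyer.Statement
import HarnessLib.Audit.Check
import Literature.NumberTheory.EllipticCurves.Kriz2020.RankOnePConverse
import Literature.NumberTheory.EllipticCurves.SelmerCorankHolds
import Literature.NumberTheory.EllipticCurves.IwasawaLeadingTermProofs
import HarnessLib.Audit.Status.Attr

/-!
Route: CongruentShaFreeCut

# Route CongruentShaFreeCut — Kriz's rank-one 2-converse for E_n cut at Sha-freeness (BKO Thm 1.5 /
Rem 1.6 shape) at the ramified CM prime 2

It suffices to show X = X_A ∧ X_B for the congruent number curves E_n : y² = x³ − n²x (n ≠ 0; CM by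
ℤ[i],
p = 2 the RAMIFIED CM prime, additive reduction): X_A (Ш-freeness half) «corank_{ℤ₂}
Sel_{2^∞}(E_n/ℚ) = 1 ⟹
rank E_n(ℚ) ≥ 1», and X_B (Ш-finite converse) «rank E_n(ℚ) = 1 ∧ Ш(E_n/ℚ)[2^∞] finite ⟹ ord_{s=1}
L(E_n,s) = 1».
This closes rung S2 of BirchSwinnertonDyer (D-0061): the registered leaf
`rankOne_twoConverse_congruentNumber`
(Kříž 2020 Thm 10.13 shape), the ONE hypothesis under which «E_n satisfies rank-BSD for 100 % of
square-free
n ≡ 5,6,7 (8)» is already a tree theorem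
(`Kriz2020.bsdRank_densityOne_congruentNumber_of_converse_of_smith2022`).
The cut is the printed one of Burungale–Kobayashi–Ota 2024: Thm 1.5 (= X_B shape, proved at INERT p
≥ 5) versus
the refined converse (1.6) of Rem 1.6(ii) (= the leaf shape, open at non-split p); no idea card is
realised (cell directive D-0059/D-0061).
Lean:
`Summit.BirchSwinnertonDyer.BirchSwinnertonDyer.Theses.CongruentShaFreeCut.RankPosOfTwoSelmerCorankOne
∧
Summit.BirchSwinnertonDyer.BirchSwinnertonDyer.Theses.CongruentShaFreeCut.AnalyticRankOneOfRankOneFiniteShaTwo`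

## Assembly
Pure logic over two tree theorems: given n ≠ 0 and corank_{ℤ₂} Sel_{2^∞}(E_n) = 1, crux A gives rank
≥ 1; the corank identity
`selmerCorank_eq_mordellWeilRank_add_holds 2` (corank = rank + shaCorank) forces rank = 1 and
shaCorank 2 = 0 (omega); the tree
equivalence `finite_primaryComponent_sha_iff_shaCorank_eq_zero` turns shaCorank = 0 into `Finite
(Ш[2^∞])`; crux B returns
analyticRank = 1, i.e. the leaf. The item `Assembly` records this implication and the deciding
theorem `closes` (glue.lean) consumes it;
its proof (provable now, ~8 lines: `intro n hn hc; haveI := isElliptic_congruentNumberCurve hn;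
haveI : Fact (Nat.Prime 2) := ⟨Nat.prime_two⟩;
have := (congruentNumberCurve n).selmerCorank_eq_mordellWeilRank_add_holds 2; have := hA hn hc; …
omega …;
exact hB hn hrank ((finite_primaryComponent_sha_iff_shaCorank_eq_zero _ 2).2 hsha)`) is the first
prover target.
Converse bookkeeping (stated for the tribunal, T1 conjunct reading): modulo Gross–Zagier–Kolyvagin
(tree HYPOTHESIS
`rank_eq_analyticRank_of_analyticRank_le_one`, a theorem in print, not a tree theorem) the leaf
implies crux A, and by the tree lemma
`selmerCorank_eq_one_of_mordellWeilRank_eq_one_of_finite` it implies crux B outright; so A ∧ B is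
the conjunct split of the leaf along
the printed BKO 2024 cut (their `selmerCorank_eq_one_and_finite_iff_rank_eq_one_and_finite`).
TRIBUNAL CONJUNCT READING (D-0033 T1r; see KILL CRITERIA): the route ATTACKS X_B =
`AnalyticRankOneOfRankOneFiniteShaTwo`
(a prover on the printed-input line `heegner-field-gz`; BC5 rung LANDED:
`Theorems.CongruentShaFreeCutRungSupersingular.stub_rung_supersingular`, E_n at a
good supersingular prime) and DECLARES X_A = `RankPosOfTwoSelmerCorankOne` the RESIDUAL conjunct
(still worked in this cell by the transfer seat's FW v2
repair bundle, research-grade, and claimable on its registered line); neither conjunct alone gives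
the leaf (kernel t1r not-joint: leaf → A and
leaf → B do not close).

CLOSES_TARGET: closes rung S2 of BirchSwinnertonDyer: Literature.NumberTheory.EllipticCurves.rankOne_twoConverse_congruentNumber (D-0061; not the summit Statement) — the deciding theorem of this route concludes that registered leaf instead of the Statement decl `BirchSwinnertonDyer` (class rung: servable and labelled, never counted as concluding the summit Statement).

Rationale: WHY THIS LINE. Mechanism: at a NON-SPLIT CM prime the p-converse splits along `corank Sel_{p^∞} =
rank + corank Ш[p^∞]` (tree theorem
`selmerCorank_eq_mordellWeilRank_add_holds`) into (A) producing a rational point from corank one —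
an anticyclotomic main
conjecture for K = ℚ(i) at the ramified prime (1+i) plus a (virtual) Heegner / elliptic-unit class
whose non-triviality is read off
a Rubin-type p-adic L-value (Kriz2020 §§9–10, arXiv:2002.04767v5; FanWan2023 = arXiv:2304.09806v2
Thm 1.1 [ThmM]; ramified-prime
Iwasawa theory of BurungaleKobayashiNakamuraOta2026 = arXiv:2608.06879, p ≥ 5 only) — and (B)
turning a point of infinite
order plus finite Ш[2^∞] into r_an = 1 — a Rubin-type formula L_p(1) = (log_ω P)²/period·unit
(BurungaleKobayashiOta2023 Thm 1.1
shape), non-vanishing of log_ω P for non-torsion P (elementary: the kernel of the formal-group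
logarithm on E(ℚ_p) is the torsion, Silverman AEC IV.6.4(b); arXiv:2603.20886 Thm 1.1 is the
abelian-variety refinement, not needed), an explicit
reciprocity law and Gross–Zagier (Darmon2004 Thm 3.22). Imported areas: CM Iwasawa theory (Rubin1991
two-variable main
conjecture, whose p ∤ #𝒪_K^× hypothesis EXCLUDES p = 2 for ℚ(i) — the crux), p-adic Waldspurger/BDP
formulae, Heegner points.
What it does that prior routes do not: the 19 open BSD routes attack the summit conjunction or
formula cells; none targets the
rank-one 2-converse leaf, and the two claimed proofs in print (Kriz2020 v5, FanWan2023 v2) are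
unrefereed with cell-audited gaps
(HOME/VERDICT.md Parts I–V: Prop "Int" at ramified 2, App-B/App-A identification, ±-control) — this
route makes the two
halves separately claimable so a prover can land (B) from printed inputs while (A) carries the
research-grade debt.

RANKED CRUXES. #2 RankPosOfTwoSelmerCorankOne (crux) — Ш-freeness half at p = 2 for the congruent
number family: for every n ≠ 0, if the 2^∞-Selmer group of E_n/ℚ has ℤ₂-corank 1 then E_n(ℚ) has a
point of infinite order (rank ≥ 1). Equivalent, given corank 1, to «Ш(E_n/ℚ)[2^∞] is finite» (corank
identity). [difficulty: open-problem] (why it might fail: needs a CM main conjecture + control at p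
= 2 | #𝒪_K^× (Rubin1991 excludes p | w_K; BKNO 2026 ramified theory is p ≥ 5) and a non-torsion
(virtual) Heegner class; Kriz2020 v5 / FanWan2023 v2 claim it but are unrefereed with audited gaps
at exactly this step.) [Kriz2020, FanWan2023, BurungaleKobayashiNakamuraOta2026, Rubin1991,
BurungaleKobayashiOta2023, Tian2014]
#3 AnalyticRankOneOfRankOneFiniteShaTwo (crux) — Ш-finite 2-converse for the congruent number family
(BKO 2024 Thm 1.5 shape at the RAMIFIED prime 2): for every n ≠ 0, if rank E_n(ℚ) = 1 and
Ш(E_n/ℚ)[2^∞] is finite then ord_{s=1} L(E_n, s) = 1. [difficulty: XL] (why it might fail: BKO Thm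
1.5 is proved for p ≥ 5 INERT with ERL + Rubin's formula; at p = 2 ramified in ℚ(i) with additive
reduction of E_n no Rubin-type formula / explicit reciprocity law is in refereed print (FanWan2023
v2 Thm 4.2/4.4 [ERC1/ERC2] + Thm 6.9 claim them, unrefereed; in print the cut stops at GOOD
reduction: supersingular incl. 2,3 = Burungale–Skinner Thm A.1 in arXiv:2210.10730 App. A
(preprint), ordinary = BCST 2022 Thm A — the obstruction is the ADDITIVE reduction of E_n at 2; ABSV
syntomic input printed for p odd).) [BurungaleKobayashiOta2023, FanWan2023, arXiv:2210.10730,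
BertoliniDarmonPrasanna2013, Darmon2004, BurungaleCastellaSkinnerTian2022]

TWO-LAYER PLAN. Foreseen split of RankPosOfTwoSelmerCorankOne (filed only after a prover proposes
it): A ⇐ A1 → A2 → A with A1 = «a 2-adic anticyclotomic
main conjecture with control for E_n over ℚ(i) (resp. a genus field ℚ(i,√m)) bounding corank Sel by
the order of vanishing of a Rubin/BDP-type
2-adic L-function» and A2 = «that L-function has a simple zero / its derivative value is the 2-adic
logarithm of a (virtual) Heegner class, which is
then non-torsion» — exactly Fan–Wan v2's own decomposition (Thm 5.18 [RMCC] anticyclotomic main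
conjecture + Thm 4.2/4.4 [ERC1/ERC2] explicit reciprocity laws + Thm 6.9 virtual-Heegner
non-torsion, assembled as Thm 1.1 [ThmM]; there is no «Thm 1.6» in v1/v2 — LIT-G14 E1); objects
(Λ-adic Selmer over the ℤ₂-anticyclotomic tower at a ramified prime) are not
tree-typed today, so these are informal workitems first. Crux B's foreseen split: B1 = Rubin-type
formula at p = 2 for E_n (value of the
anticyclotomic 2-adic L-function at trivial character = (log_ω P)²/Ω up to a 2-unit), B2 =
reciprocity law «Ш[2^∞] finite ∧ rank 1 ⇒ that value has
the predicted order», then GZ. TYPED AND LANDED 2026-08-26 (typer bsd-cn100-ty g2, filed by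
transfer-2 as p424074 `Theorems/CongruentShaFreeCutTwoAdicLinks.lean`): B ⇐
`TwoAdicControlOfRankOne` (Link A, algebraic: anticyclotomic control at the ADDITIVE prime 2 over an
auxiliary Heegner field with 2 split, currency `AcSelmer.XAc.HasCharValuationAt`) →
`TwoAdicCharValueEqHeegnerLogSq` (Link B, analytic: main conjecture ∘ 2-adic Waldspurger/BDP at 𝟙,
Literature predicate `AcPConverseLinks.CharValueEqLogSqAt`, generic half LANDED p421775) →
`HeegnerNonTorsionAtTwo` → B, glue PROVED (`heegnerNonTorsionAtTwo_of_twoAdicLinks`,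
`cruxB_of_twoAdicLinks`; six refereed facts as named hypotheses); both links are theorems in print
at good ordinary p > 2 / p ∥ N and OPEN at an additive prime. They were crux B's registered skeleton
`two-adic-links` v3/v4; since 2026-08-26T10:12Z Link A is a kernel theorem modulo Poitou–Tate
(p432373) and Link B is RE-CUT in pinned-𝓛 BDP currency as the line of record `two-adic-bdp-triple`
v5 (REGISTERED LINES below) and, in corank currency, crux A's (`heegner-field-links` v3–v5 → since
2026-08-26T12:06Z `heegner-field-bdp-triple` v6b: (res) + the SAME BDP triple as crux B, every
algebra step between them LANDED — base finiteness p437699, tower control p429171, census p440764) —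
the A1/A2 of this paragraph realised over the auxiliary field instead of ℚ(i).

KILL CRITERIA. A refutation of either crux (an explicit n with corank_{ℤ₂} Sel_{2^∞}(E_n) = 1 and
rank 0, i.e. Ш(E_n)[2^∞] infinite — contradicting
finiteness of Ш, so none is expected; or rank 1, Ш[2^∞] finite, r_an ≥ 3) closes the route
`refuted:<Decl>` and refutes the leaf itself. A
refereed publication of Kriz2020 / FanWan2023 moots the route (the leaf becomes a citable fact; as
of 2026-08-25 NO paper cites Kriz2020 or FanWan2023 as a theorem — Smith arXiv:2503.17619 cites
neither and its p.3
Remark treats the rank-one 2-converse as not established; LIT-STATUS-MEMO §A, LIT-G14 E2). If crux A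
is shown EQUIVALENT to the leaf by a cheap tree argument NOT using crux B, the cut is cosmetic →
pivot to the
Heegner-field form (corank over K_m = 1 ⇒ P_m non-torsion for Tian's genus points) as crux A′.
CONJUNCT READING (D-0033 T1r; declared 2026-08-25 plan g8, no statement change): jointly A ∧ B ⟺ the
leaf modulo tree facts (leaf → B by the corank identity, leaf → A by Gross–Zagier–Kolyvagin) — the
expected reading of a conjunct cut, not a kill (birth kernel: t1r partial-joint; BC2 probes C → leaf
failed 2/2, neither conjunct alone gives the leaf). The route ATTACKS B =
AnalyticRankOneOfRankOneFiniteShaTwo (deciding crux; BC5 witness = the BKO good-supersingular rung,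
registered stub `stub_rung_supersingular` LANDED p410927; lever = Rubin-type formula + explicit
reciprocity law at the ADDITIVE prime) and DECLARES A = RankPosOfTwoSelmerCorankOne the RESIDUAL
conjunct (imported complement, exempt from T3/T4, counted once; its registered line is
`heegner-field-bdp-triple` v6b since 2026-08-26T12:06Z (was `heegner-field-links` v3–v5): open stubs
`stub_twoLocNonDegeneracy` [XL, (res)], the three BDP stubs SHARED token-for-token with crux B's
line [(LB-exist)/(LB-wan)/(LB-bdp)], `stub_textbookDualityImQuad` [textbook: Poitou–Tate at
imaginary quadratic K] — CLOSED 2026-08-26 p455245, `stub_refereedInputs` [citation-borne];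
`stub_selmerAcBaseFinite_of_resCorankOne` LANDED p437699; rung `stub_rung_monskyUncovered` LANDED
p419763). Tribunal re-runs pass FULLY-QUALIFIED roles (a bare `--residual` name is silently treated
as attacked): `--residual
Summit.BirchSwinnertonDyer.BirchSwinnertonDyer.Theses.CongruentShaFreeCut.RankPosOfTwoSelmerCorankOne
--witness
Summit.BirchSwinnertonDyer.BirchSwinnertonDyer.Theorems.CongruentShaFreeCutRungSupersingular.stub_rung_supersingular
--s-case
Literature.NumberTheory.EllipticCurves.BurungaleKobayashiOta2024.thm15_analyticRank_eq_one_of_selmerCorank_eq_one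
--method-family "anticyclotomic-iwasawa rubin-formula gross-zagier"` (the same object is filed as
the route's `tribunal_fit`). TYPING CAVEAT on the BDP triple (bsd-cn100-s2-c3 g5 design remark,
STATUS 2026-08-26T11:55:26Z, from its g2 DESIGN-NOTE-g2-supercuspidal-at-two.md §2; not a
refutation): (LB-exist) `TwoAdicBDPElementExists` pins the ABSOLUTE normalisation of the tree's
schema `IsBDPLFunction` (value at φ of type (n,−n) = ι'⁻¹(`bdpInterpolationValue 2 f v φ n
Ω_K`)·Ω_p^{4n}, Ω_K ∈ ℂˣ free, Ω_p ∈ R₀ˣ); the true constant of a 2-adic BDP element for (f_{E_n},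
2) at the supercuspidal prime is in NO source (local factor (1 − a₂2⁻¹φ(𝔭) + ε₂φ(𝔭)²)² = 1 there; a
φ-independent local constant is plausible at the SPLIT place v), an n-independent factor C with ord₂
C ≤ 0 is absorbed by 𝓛 ↦ C⁻¹𝓛, but ord₂ C > 0 beyond the 2-content of 𝓛 would make (LB-exist) FALSE
FOR A NORMALISATION REASON ONLY, with (LB-wan)/(LB-bdp) then vacuous. A refutation of (LB-exist) of
that kind is classed MISSTATED in advance, repair prescribed (additive, stub-add + re-registration):
(LB-exist′) over a 2^a-scaled frame «∃ a : ℕ, … 𝓛 ∈ R₀⟦T⟧ interpolates 2^a × the schema values»,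
(LB-wan′) unchanged in form (the 2^k slack absorbs a), (LB-bdp′) with u ∈ R₀, u ≠ 0 in place of a
unit (the landed plumbing never uses that u is a unit: log_ω P' = 0 ⟹ 𝓛(0) = 0 regardless); plumbing
p438932 and the character-supply port p442134 are schema-agnostic and port verbatim. AUDIT ANSWERED
2026-08-26T17:12Z (MEMO-transfer-12, HOME/MEMO-transfer-12.md sha256 e069cfef90c573b4…, transfer g9;
evidence #18 on 19080 / #25 on 19079; kit j256674): (LB-exist) EXACT `TwoAdicBDPElementExists` is
UNSATISFIABLE AS TYPED at p = 2 for every square-free n and every K with 2 split — the display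
`IsBDPLFunction` (Castella2018 Thm 3.1 verbatim) abbreviates the refereed interpolation formula
[CastellaHsieh2018 = arXiv:1505.08165 Prop 3.6; Hsieh2014 Thm 5.6 / Prop 5.2], whose residual
CONSTANT c = 2·ε(f)·u_K²·√D_K (after absorbing A^n into Ω_K and a unit Iwasawa function into 𝓛) has
2-adic image √−1·2·unit with √−1 ∉ Frac R₀ = ℚ̂₂^{ur} (memo Prop 4.1, given one non-vanishing pair
of central values [CastellaHsieh2018 Thm 3.7]; numerical cross-check f₃₂, K = ℚ(√−7): y·√7 = 543²/2
to 30 digits, functional equations to 2^{−122}); (LB-wan)/(LB-bdp) EXACT are then VACUOUS; the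
2^a-scaled (LB-exist′) below would NOT have repaired it (memo §5.2: the defect is the ramified unit
√−1, not the valuation) — but the ♯ frame of the DECISION below DOES: the memo's own repair spec
(§5.3, a scalar slot C) is, up to the transport C_tree = ι'⁻¹(C_memo) ∈ ℚ̄₂ˣ ⊂ ℂ₂ˣ, exactly the
landed `IsBDPLFunctionUpTo (C : ℂ_[2])` / p450060 frame carried by the lines of record, and its
truth check ports verbatim (C := ι'⁻¹(c), 𝓛 := U⁻¹·L₂ ∈ R₀⟦T⟧). PLAN DECISION 2026-08-26T17:17:17Z:
finding ACCEPTED; NO re-cut, NO re-registration; (LB-exist) EXACT recorded REFUTED-AS-TYPED at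
research-note grade (class MISSTATED, anticipated here; it is on no registered line and no item
depends on it; a tree-grade conditional `¬ TwoAdicBDPElementExists` is optional negative knowledge).
DECISION 2026-08-26T13:33:52Z (plan g13, memo
HOME/bsd-cn100-plan/routes-g13/DESIGN-LBexist-normalisation-g13.md 28d95f8cfe1ee17b): the repair
branch is TAKEN, in the normalisation-INVARIANT shape «BDP triple UP TO A NONZERO CONSTANT» which
supersedes the 2^a-scaled prescription — new Literature frame `IsBDPLFunctionUpTo (C : ℂ_[p]) ι 𝔭 κ
γ f Ω_K Ω_p 𝓛` (value = C · display value · Ω_p^{4n}; `C = 1` ↔ `IsBDPLFunction`), (LB-exist♯)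
`TwoAdicBDPElementExistsUpTo` (∃ … C ≠ 0 …), (LB-wan♯) `TwoAdicWanDivisibilityUpTo` (∀ … C ≠ 0 …,
same divisibility), (LB-bdp♯) `TwoAdicBDPValueAtOneUpTo` (… ∃ u : ℂ_[2], u ≠ 0 ∧ 𝓛(𝟙) = u·c⁻²·(1 −
a₂2⁻¹ + [2∤N]2⁻¹)²·(log_ω P)²) — bodies lean-checked in the planner sketch
routes-g13/bc/BDPTripleUpTo_sketch_p2.lean cb3cc10da9fe9c6e (rc 0; exact ⟹ ♯ proved for (LB-exist)).
EVIDENCE: the schema is Castella CJM 2018 Thm 3.1 verbatim [arXiv:1704.06608 p.9]; the only printed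
constant ledger behind it (Castella–Hsieh 2018 Prop 3.4/3.6 [arXiv:1505.08165 p.10–11]) carries
2^{#A(ψ)+3}·u_K²·√D_K·c·ε(f) and (4π)^{2n+1}(Im ϑ)^{2n} outside the display; n-th powers are
absorbed by the free Ω_K, φ(𝔞)/φ̂(Frob)-monomials are unit Iwasawa functions, and the residual
constant has ord₂ = #A(ψ)+1 ≥ 1 at a Heegner field with 2 split — «positive valuation or
undeterminable ⟹ repair». The audit of record is bsd-cn100-transfer g9's MEMO-transfer-12 (STATUS
13:02:00Z), its weight redirected to the SHAPE of the φ- /n-dependence at the split additive place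
(memo §3(e)), which ♯ does not absorb. Kernel follow-up (s2-c3 seat, after the (F1) campaign): the
frame file + `Theorems/CongruentShaFreeCutTwoAdicBDPTripleUpTo.lean` (defs verbatim + ports of
p438932/p440516/p440764); the plan seat registered v5d `two-adic-bdp-triple-upto` (19080,
c82314e4ce805155) / v6c `heegner-field-bdp-triple-upto` (19079, 84c7306c34358f0e) at 14:28Z — the
registry keeps ONE active skeleton per item, so the exact stubs of v5c/v6b are INACTIVE since then
(exact proofs still credit via `twoAdicBDPElementExistsUpTo_of_exact` / C = 1).

NOT DECOMPOSED YET. The Iwasawa-theoretic interior of crux A (which tower: ℤ₂-anticyclotomic over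
ℚ(i) vs Kříž's ∞-level modular curve; which L-function:
Rubin/Katz-type at ramified 2 vs Kříž's supersingular measure; the control theorem at additive
reduction; the choice of auxiliary genus
field making the Heegner hypothesis hold for conductor 32n²) is deliberately NOT decomposed: the
objects are not in the tree and the two
claimed proofs decompose it differently (VERDICT.md Part II §5 lists FW's seven repair items
(a)–(h)); they are NOT filed as items (BC6: an item outside the cone of `closes` flips the route to
draft) — they live in the line cards
HOME/bsd-cn100-plan/routes-g6/lines/fw-ramified-tower.{S2,S2b}.md and the transfer bundle
MEMO-transfer-1..7 (two-read, VERDICT IX-A).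
REGISTERED LINES — S2 PT-FREE CENSUS LANDED 2026-08-26T17:02Z p457436
`Theorems/CongruentShaFreeCutCensusPTFree.lean` (s2-c3 g7, commit 84f66d20ebef, `--supports 19080
--as helper`): **`twoAdicControlOfRankOne_holds :
CongruentShaFreeCutTwoAdicLinks.TwoAdicControlOfRankOne` — LINK A of crux B (the `@[conjecture]` def
of p424074) is now an UNCONDITIONAL tree theorem** (base finiteness p432373 ∘ tower control p429171
∘ Poitou–Tate p455245); `cruxB_of_bdpTripleUpTo (hpar) (hmod) (hHL) (hKato) (hHP) (hGZ) (hE :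
TwoAdicBDPElementExistsUpTo) (hWan : TwoAdicWanDivisibilityUpTo) (hV : TwoAdicBDPValueAtOneUpTo) :
AnalyticRankOneOfRankOneFiniteShaTwo` = **crux B ⟸ six refereed facts + the (LB-*♯) triple, no
textbook hypothesis**; `cruxA_of_res_of_bdpTripleUpTo` / `leaf_of_res_of_bdpTripleUpTo` /
`cruxA_iff_res_of_bdpTripleUpTo` (19079 services) and the exact-triple variants. (F1) CLOSED
2026-08-26T15:47Z — `stub_textbookDualityImQuad` PROVED token for token by
`Summit.BirchSwinnertonDyer.BirchSwinnertonDyer.Theorems.CongruentShaFreeCutTextbookDualityImQuad.stub_textbookDualityImQuad`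
(p455245, commit 000139ff30f0, bsd-cn100-transfer-2 g4; via `IsImaginaryQuadratic.isTotallyComplex`
from the new tree theorem
`Literature.NumberTheory.GaloisCohomology.poitouTate_sum_localTatePairing_eq_zero_of_isTotallyComplex`
(p455046, `PoitouTateSumTotallyComplex.lean`: Poitou–Tate Σ_v inv_v = 0 for EVERY totally complex
number field, sorry-free); campaign nodes: R p446842, T-loc p444126, T-eval p445753, Kummer/Hensel
p448757, T-surj p446916 (+ p447260), T-kill p447758/p448559/p450258, level change p448922, layer
character p449603, T-pre = character supply p452028 + p454062 (ty g6) + correction assembly p451184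
+ p453756 (transfer-2 g4) (arbitrations 12:25:41Z, 14:53:48Z, 15:13:59Z), N6 assembly p450157);
registry credit: 19079 via `--supports` at acceptance of p455245; 19080 (and 19079 again, uniformly)
via RE-REGISTRATION 2026-08-26T16:36Z — a 1-line credit wrapper bounces `dedup.landed` (s2b-c3 g5
16:25:25Z), so the plan seat re-registered both skeletons with the textbook stub REMOVED and the
landed theorem CALLED BY NAME: **lines of record since 16:36Z = `two-adic-bdp-triple-upto` v5dp
(19080,
HOME/bsd-cn100-plan/routes-g13/bc/ptfree/AnalyticRankOneOfRankOneFiniteShaTwo_twoAdicBDPTripleUpTo_v5dp.lean,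
sha16 8bbc978f5560bce5, rc 0, sorries 4 = stubs {`stub_refereedInputs`,
`stub_twoAdicBDPElementExistsUpTo`, `stub_twoAdicWanDivisibilityUpTo`,
`stub_twoAdicBDPValueAtOneUpTo`}) and `heegner-field-bdp-triple-upto` v6cp (19079,
…/ptfree/RankPosOfTwoSelmerCorankOne_heegnerFieldBDPTripleUpTo_v6cp.lean, c1b04d14a1c8a32b, rc 0,
sorries 5 = the same four + `stub_twoLocNonDegeneracy`)** — every remaining stub token-identical
with v5d/v6c (nothing else expired; registry readback 16:37Z: active stubs exactly these). REMAINING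
OPEN STUBS: the research statements only ((LB-exist♯)/(LB-wan♯)/(LB-bdp♯) on S2, the exact triple on
S2b, (res) on crux A of each) + the citation-borne `stub_refereedInputs`. UPDATE 2026-08-26T14:28Z
(plan g13; files HOME/bsd-cn100-plan/routes-g13/bc/, SHA16.txt): THE LINES OF RECORD ARE NOW THE
♯-LINES «BDP triple UP TO A NONZERO CONSTANT» (decision 13:33:52Z executed in the kernel by
bsd-cn100-s2-c3 g6: frame `Literature.NumberTheory.EllipticCurves.IsBDPLFunctionUpTo` p449712
eda3949962b04671; statements
`…Theorems.CongruentShaFreeCutTwoAdicBDPTripleUpTo.{TwoAdicBDPElementExistsUpTo,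
TwoAdicWanDivisibilityUpTo, TwoAdicBDPValueAtOneUpTo}` (@[conjecture] defs, bodies verbatim from the
planner sketch cb3cc10da9fe9c6e) + sanity `twoAdicBDPElementExistsUpTo_of_exact` + the ported
plumbing `heegnerNonTorsion_of_linkA_of_bdpTripleUpTo` and census
`cruxB_of_bdpTripleUpTo_of_poitouTate_imaginaryQuadratic` p450060 2d86f7dd6426b81b; corank plumbing
+ `rankPos_squarefree_of_corankLinkA_of_bdpTripleUpTo` +
`cruxA_of_res_of_bdpTripleUpTo_of_poitouTate` p450735 51081c9eb4f2bc2a). Crux B (19080):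
**`two-adic-bdp-triple-upto` v5d** (skeleton c82314e4ce805155, registered 2026-08-26T14:28:11Z;
`lean check` rc 0, sorries 5 = stubs {`stub_refereedInputs`, `stub_textbookDualityImQuad` —
token-identical with v5c —, `stub_twoAdicBDPElementExistsUpTo : TwoAdicBDPElementExistsUpTo`,
`stub_twoAdicWanDivisibilityUpTo : TwoAdicWanDivisibilityUpTo`, `stub_twoAdicBDPValueAtOneUpTo :
TwoAdicBDPValueAtOneUpTo` BY NAME over p450060}; composition
`AnalyticRankOneOfRankOneFiniteShaTwo_of_stubs :=
cruxB_of_bdpTripleUpTo_of_poitouTate_imaginaryQuadratic …` concludes crux B BY NAME, audit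
proof-of-item). Crux A (19079): **`heegner-field-bdp-triple-upto` v6c** (skeleton 84c7306c34358f0e,
registered 14:28Z; rc 0, sorries 6 = stubs {`stub_refereedInputs`, `stub_textbookDualityImQuad`,
`stub_twoLocNonDegeneracy` — token-identical with v6b —, the three ♯ stubs}; composition through
p450735 + the v6b ImQuad glue verbatim, concludes crux A BY NAME). BC3 probes
routes-g13/bc/S2_upto_stub_probes.lean bdac8edee3c3bca8 (probe-only, `exact? | simpa | aesop`,
maxHeartbeats 400000): (LB-exist♯)/(LB-wan♯)/(LB-bdp♯) → B ✗✗✗, → A ✗✗✗, → leaf ✗✗✗, outright ✗✗✗ —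
12/12 MUST-FAIL fail, residual goals display the full bodies (non-vacuous). REGISTRY SEMANTICS (one
active skeleton per item): the exact stubs `stub_twoAdicBDPElementExists` /
`stub_twoAdicWanDivisibility` / `stub_twoAdicBDPValueAtOne` of v5c/v6b are now INACTIVE on
19080/19079 (archived, sha ad78c0f7 / 0da14fea); the exact statements stay landed (p438932) and an
exact filing is still creditable: (LB-exist) ⟹ (LB-exist♯) by `twoAdicBDPElementExistsUpTo_of_exact`
(3-line wrapper), (LB-wan♯) ⟹ (LB-wan) (C = 1) while (LB-wan) ⟹ (LB-wan♯) and (LB-bdp) ⟸⟹ (LB-bdp♯)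
only modulo existence + rigidity (unramified valuations: C ∈ 2^ℤ·R₀ˣ once an exact element exists) —
so the ♯ triple is the weakest-typed form of the same research content, normalisation-invariant, and
the one served. WHY ♯ (KILL CRITERIA «TYPING CAVEAT» executed): the exact display demanded of
(f_{E_n}, 2) is Castella 2018 Thm 3.1's [arXiv:1704.06608 p.9], whose only printed constant ledger
(Castella–Hsieh 2018 Prop 3.4/3.6 [arXiv:1505.08165 p.10–11]) leaves a residual 2^{#A(ψ)+1}, ord₂ ≥
1, at a Heegner field with 2 split — exact (LB-exist) plausibly false BY NORMALISATION with
(LB-wan)/(LB-bdp) then vacuous; ♯ removes every φ-,n-independent constant (2-powers, u_K², √D_K, c,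
ε(f), transcendental/sign slips) and does NOT absorb SHAPE errors of the local multiplier at the
supercuspidal place (audit of record: bsd-cn100-transfer g9 MEMO-transfer-12). The g12 record of the
exact lines follows unchanged. REGISTERED LINES (g12 record; BC3; registry = `ledger workitem stubs
<item>`; files HOME/bsd-cn100-plan/routes-g12/bc/, SHA16.txt; earlier versions under routes-g11/bc/,
routes-g8/bc/). SINCE 2026-08-26T12:06Z BOTH CRUXES RUN ON ONE SHARED RESEARCH SET: the 2-adic BDP
triple {(LB-exist), (LB-wan), (LB-bdp)} (stubs token-identical on 19079 and 19080 — ONE filing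
`theorem stub_twoAdicWanDivisibility : TwoAdicWanDivisibility` etc. credits both cruxes), plus (res)
on crux A only; textbook = Poitou–Tate AT IMAGINARY QUADRATIC FIELDS (`stub_textbookDualityImQuad :
∀ K, IsImaginaryQuadratic K → poitouTate_sum_localTatePairing_eq_zero K`, token-identical on all
four crux items of S2/S2b — the (F1) campaign's totally-complex milestone F-a + F-c(light) + F-d of
HOME/bsd-cn100-ty/F1-SUPPLY-MAP-g5.md §5 closes it via `IsImaginaryQuadratic.isTotallyComplex`, the
∀ K theorem by specialisation); citation-borne = `stub_refereedInputs`. Crux A (19079, residual) —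
LINE OF RECORD **`heegner-field-bdp-triple` v6b** (skeleton 0da14fea1057ca4b, registered
2026-08-26T12:06:19Z by plan g12; RankPosOfTwoSelmerCorankOne_heegnerFieldBDPTriple_v6b.lean; `lean
check` rc 0, sorries 6 = the stubs, `RankPosOfTwoSelmerCorankOne_of_stubs` concludes the crux by
name; lineage: `heegner-field-links` v3 97539806 (transfer-2 g2, module-currency cut) → v4 74dedb74
(Link A re-cut along Skinner's architecture) → v5 e11896bb (plan g11 08:23Z, re-synced to
p429171/p429679; carried the OLD Link B `stub_twoAdicCharValueEqHeegnerLogSq` — currency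
`AcPConverseLinks.CharValueEqLogSqAt`, free u — as its only analytic stub, a statement s2-c3 g4
showed ⟺ its torsion half ⟺ crux B on crux data, p436218/p433291, attacked by no line once crux B
moved to the BDP triple) → `heegner-field-bdp-triple` v6 5ffb8642 (plan g12 11:44Z: old Link B and
the fact-conditional supply stubs `stub_descentField`/`stub_heegnerPointSupply` DROPPED, the BDP
triple BY NAME added, composition = s2b-c3 g3's census p440764) → v6b (Poitou–Tate weakened to
imaginary quadratic K)): the Ш-freeness half CUT WITH TEETH over an auxiliary Heegner field K (2
split in K, E_n still ADDITIVE at 2) — no posited L-function outside the BDP frame, no ∃-junk: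
`stub_refereedInputs` [S, CITATION-BORNE: 2-parity, modularity, Hoffstein–Luo, Kato, Gross 1984 —
the five hypothesis types of the census theorem, replacing v5's fact-conditional `stub_descentField`
(= conclusion of p412958) and `stub_heegnerPointSupply` (Gross)], `stub_textbookDualityImQuad` [M–L
TEXTBOOK FACT, Milne ADT I 4.10(b)/2.3, at imaginary quadratic K only — all Link A ever uses] —
CLOSED 2026-08-26 p455245, **`stub_twoLocNonDegeneracy`** [XL OPEN — THE RESEARCH KERNEL in SELMER
currency, «(res)»: for K imaginary quadratic with 2 split and corank_{ℤ₂} Sel_{2^∞}(E_n/K) = 1, the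
w-strict Selmer group `Sel_{2^∞}(E_n/K) ⊓ ker loc_w` (tree: `selmerGroupPInfty 2 ⊓
selmerLocalKerPrimaryTorsion … (w.adicCompletion K) 2`, the `hloc` of bsd.S25) is FINITE at every w
∣ 2 — Skinner 2020 Thm B's localisation hypothesis, which W. Zhang 2014 (Camb. J. Math. 2, Thm 1.3 +
p.198 Remark 2 [corpus:paper:doi-10-4310-cjm-2014-v2-n2-a2 p.8]) removes at good ordinary p ≥ 5 via
Kolyvagin systems; under rank 1 ∧ #Ш[2^∞] < ∞ it IS the tree theorem
`finite_strictSelmer_of_mordellWeilRank_eq_one_of_hom`; crux A ⇒ (res) cheaply, (res) ⇒ A only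
through the links — a consequence of A used toward A; OPEN at additive 2; Selmer-only (no
L-function, no Iwasawa module), hence also open to 2-DESCENT methods on the congruent family],
**`stub_twoAdicBDPElementExists` / `stub_twoAdicWanDivisibility` / `stub_twoAdicBDPValueAtOne`**
[XL/XL/L–XL OPEN — (LB-exist)/(LB-wan)/(LB-bdp) BY NAME over the LANDED `@[conjecture] def`s of
p438932, token-identical with crux B's line (descriptions under crux B below); on THIS line they
discharge what the old Link B asserted: (res) + algebra + PT give a generator F of char_Λ 𝔛 with
F(0) ≠ 0 at corank-one data, (LB-wan) along j gives 𝓛(0) ≠ 0, (LB-bdp) turns that into log_ω y_K ≠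
0, hence a non-torsion Heegner point, hence rank ≥ 1]; in-skeleton glue PROVED (sorry-free):
`twoAdicControlOfCorankOne_of_res_imaginaryQuadratic` = Link A in CORANK currency ⟸ (res) +
Poitou–Tate at K (the landed W,p-general algebra
`CongruentShaFreeCutSelmerFiniteOfRes.stub_selmerAcBaseFinite_of_resCorankOne` p437699 — PT → EP →
imaginary quadratic → split → corank 1 → (res) → Castella's base Selmer group
`X11b.AcSelmer.selmerAcBase (E_n/K) 2 v̄ ∅` finite; JSW17 Prop. 3.2.1 (≤) with the Kummer line
replaced by the divisible Selmer line — then tower control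
`CongruentShaFreeCutTwoAdicControlOfSelmerFinite.hasCharValuationAt_of_finite_selmerAcBase` p429171,
any prime, any reduction type; local Euler characteristic from the tree theorem
`forall_localEulerPoincareCharacteristic_adicCompletion`; = p438194 §4
`twoAdicControlOfCorankOne_of_res` with `hPT K hK`); composition
`RankPosOfTwoSelmerCorankOne_of_stubs` =
`CongruentShaFreeCutBDPTripleCensus.rankPos_squarefree_of_corankLinkA_of_bdpTriple` (descent to the
Heegner field p412958 `descentField_of_parity_of_hoffsteinLuo_of_kato`, Heegner point supply
`heegnerPointSupply_of_gross`, `heegnerPoint_not_isOfFinAddOrder_of_corankLinkA_of_bdpTriple`,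
Mordell–Weil) followed by the square-free reduction p419178
`rankPosOfTwoSelmerCorankOne_of_squarefree` — token for token the census theorem with PT restricted
to K. BC3 COSTUME PROBES (probe-only files, battery `exact? | simpa | aesop`, maxHeartbeats 400000,
no timeouts): S2_v6_stub_probes.lean 7c333201b46c8b56 — (LB-exist)/(LB-wan)/(LB-bdp) → A ✗✗✗, (res)
→ A ✗, (res) → leaf ✗, outright (res) ✗, A → (LB-*) ✗✗✗, outright A ✗ (10/10 MUST-FAIL fail) +
informational A → (res) CLOSES (p436277: (res) is NECESSARY for A, not sufficient alone);
S2_ptImQuad_probes.lean 02a36bce915edcef — PTIQ → A ✗, PTIQ → B ✗, PTIQ → leaf ✗, outright PTIQ ✗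
(4/4) + informational PT(∀K) → PTIQ closes. NET: crux A = (res) at 2 ∘ [algebra LANDED ∘ tower
control LANDED] ∘ the BDP triple; the route's XL statements are (res) and the triple. Documented
alternatives for A (inactive in the registry, files kept): v2 `fw-ramified-tower` (skeleton
106898b870b09b2c, transfer-2; the director's literal object — FW Prop 3.6 [Int] + Def 5.23 at (2,
ℚ(i)) as `stub_propInt` over the typed frame `FanWan2023.IsNonsplitRubinLFunction` p419865,
`stub_originNonvanishing` whose content LANDED as p422268 `CongruentShaFreeCutPropIntAtOrigin`,
`stub_fwPerrinRiou` [XL], `stub_descentFromGaussianField` LANDED p420484; not the line of record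
because App. A's constant system is untyped — typer g3 verdict 05:32Z: not typeable as an explicit
def — so C is existential and Prop-Int is junk-cheap up to constants, leaving the whole load in one
stub) and v1 (f37e9820, `stub_fwGaussianPoint`); the 2026-08-25 line `heegner-field-descent`
(`stub_shaFreeOverK` [XL]) likewise (HOME/bsd-cn100-plan/routes-g8/bc/). KERNEL CENSUS OF THE
RESIDUAL (s2b-c3 g3 + transfer-2 g3 + s2-c3 g4, 2026-08-26T09–11Z; 0 sorry, no def, no new fact; all
`--as helper`): p436277 `CongruentShaFreeCutLocNonDegeneracy` (`twoLocNonDegeneracy_of_rankOne`;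
`twoLocNonDegeneracy_of_cruxA : RankPosOfTwoSelmerCorankOne → <stub_twoLocNonDegeneracy verbatim>` —
(res) ⟸ crux A FACT-FREE); p437699 `CongruentShaFreeCutSelmerFiniteOfRes` = the v5 stub
`stub_selmerAcBaseFinite_of_resCorankOne` LANDED (transfer-2 g3 10:32Z, registry gate:landed; parts
p433381 `…TwoAdicSelmerLocIndex`, p433383 `…TwoAdicSelmerCorankSupplies`, p433655
`…TwoAdicSelmerFiniteCorank`) — so EVERY algebra step between (res) and Link A is a tree theorem
(p437699 ∘ p429171); p436824 + p438194 `CongruentShaFreeCutResidualCensus` (§§1–3 in the old Link-B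
currency: `cruxA_iff_res_of_linkB_of_poitouTate`; §4 `twoAdicControlOfCorankOne_of_res (hPT) (hres)
: TwoAdicControlOfCorankOne` = Link A in CORANK currency ⟸ (res) + PT, algebra discharged);
**p440764 `CongruentShaFreeCutBDPTripleCensus` (s2b-c3 g3, 11:18Z, sha16 0eb58ca5782455d6) — THE
CENSUS OF RECORD in the v6 currency: `heegnerPoint_not_isOfFinAddOrder_of_corankLinkA_of_bdpTriple`,
`rankPos_squarefree_of_corankLinkA_of_bdpTriple`, `cruxA_of_res_of_bdpTriple_of_poitouTate (hpar
hmod hHL hKato hHP hPT hres hE hWan hV) : RankPosOfTwoSelmerCorankOne`,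
`cruxA_iff_res_of_bdpTriple_of_poitouTate` — crux A ⟺ (res) modulo the BDP triple + Poitou–Tate +
five refereed facts —, `leaf_of_res_of_bdpTriple_of_poitouTate` — the leaf
`rankOne_twoConverse_congruentNumber` ⟸ {(res), (LB-exist), (LB-wan), (LB-bdp)} + Poitou–Tate + six
refereed facts (+ Gross–Zagier–Kolyvagin)**. So the NET research content of the whole route is:
(res) [Selmer-only, additive 2] + (LB-exist) + (LB-wan) + (LB-bdp) [2-adic BDP side], over the ONE
textbook debt Poitou–Tate at imaginary quadratic K; no algebra debt is left. Crux B (19080,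
attacked) — LINE OF RECORD **`two-adic-bdp-triple` v5c** (skeleton ad78c0f715aeebcf, registered
2026-08-26T12:05:56Z by plan g12; AnalyticRankOneOfRankOneFiniteShaTwo_twoAdicBDPTriple_v5c.lean;
`lean check` rc 0, sorries 5 = the stubs; = v5b 3ecd44ad23d4bb82 (plan g11 11:04:27Z) with ONE stub
re-typed — `stub_textbookDuality (∀ K)` → `stub_textbookDualityImQuad` (Poitou–Tate at imaginary
quadratic K, all Link A uses; s2-c3 g5's suggestion) — and the composition switched to s2-c3 g5's
LANDED census
`CongruentShaFreeCutTwoAdicBDPTriple.cruxB_of_bdpTriple_of_poitouTate_imaginaryQuadratic` (p440516,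
§3 APPEND of the defs file; its `∀ K` specialisation `cruxB_of_bdpTriple_of_poitouTate` alongside);
v5b superseded v5 d5774449619c15fb of 10:12Z whose three defs were skeleton-local; the three
research stubs are stated over the LANDED `@[conjecture] def`s
`…Theorems.CongruentShaFreeCutTwoAdicBDPTriple.{TwoAdicBDPElementExists, TwoAdicWanDivisibility,
TwoAdicBDPValueAtOne}` (bsd-cn100-s2-c3 g5, p438932, commit b2ed3e5147be, bodies verbatim from v5),
so a filing `theorem stub_twoAdicWanDivisibility : TwoAdicWanDivisibility` closes the registered
stub token for token; composition `AnalyticRankOneOfRankOneFiniteShaTwo_of_stubs` = p440516 = LANDED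
`CongruentShaFreeCutOfHeegnerNonTorsion.analyticRankOne_of_facts_of_heegnerNonTorsion` (p419056) fed
with the refereed inputs and `HeegnerNonTorsionAtTwo` := the LANDED plumbing theorem
`CongruentShaFreeCutTwoAdicBDPTriple.stub_heegnerNonTorsion_of_linkA_of_bdpTriple` (p438932: the v5
plumbing stub PROVED under its registered name + signature — Kato descent, X11b datum at a
degree-one prime over 2, Link A ⟹ generator F with F(0) ≠ 0, (LB-exist) ⟹ (ι', Ω, 𝓛), (LB-wan) at j
:= `X11b.Halves.toUnr 2` ⟹ 𝓛(0) ≠ 0, (LB-bdp) at the Galois conjugate P' read through the infinite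
place + `UnrSeries.eq_constantCoeff_of_hasValueAt_zero` ⟹ log_ω P' ≠ 0, torsion ⟹ log = 0 —
contradiction; no character supply used) at (Kato, Link A := LANDED
`CongruentShaFreeCutTwoAdicControlOfPoitouTate.twoAdicControlOfRankOne_of_poitouTate_imaginaryQuadratic
stub_textbookDualityImQuad` (p432373), the three BDP stubs) — every stub load-bearing; BC3 costume
probes (routes-g11/bc/S2_v5_stub_probes.lean d5c2677507fb58fe): (LB-*) → B, B → (LB-*),
(LB-wan)/(LB-bdp) → leaf and outright provability ALL FAIL (11/11) under `exact? | simpa | aesop`;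
routes-g12/bc/S2_ptImQuad_probes.lean 02a36bce915edcef: PTIQ → B / A / leaf / outright 4/4 FAIL).
KERNEL STATE: **LINK A IS A KERNEL THEOREM MODULO POITOU–TATE ONLY** (s2-c3 g3/g4: p429171
`CongruentShaFreeCutTwoAdicControlOfSelmerFinite` tower control, p429679
`CongruentShaFreeCutTwoAdicSelmerFinite` base finiteness, p432373
`CongruentShaFreeCutTwoAdicControlOfPoitouTate.twoAdicControlOfRankOne_of_poitouTate (hPT) :
TwoAdicControlOfRankOne`, the local Euler characteristic being the tree theorem
`localEulerPoincareCharacteristic_holds`); and the v3/v4 research stub Link B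
`TwoAdicCharValueEqHeegnerLogSq` (currency `AcPConverseLinks.CharValueEqLogSqAt`, a FREE constant u
≠ 0) was shown by s2-c3 g4 to be (Link A + GZK) ∧ its TORSION HALF «corank 1 ∧ y_K torsion ⟹ 𝔛
torsion ∧ F(0) = 0» (p436218 `CongruentShaFreeCutLinkBHalves.linkB_iff_torsionHalf`) and, on crux-B
data, ⟺ crux B (p433291 `CongruentShaFreeCutLinkBStructure`; census p429895 `cruxB_of_linkB`,
p432373 `cruxB_of_linkB_of_poitouTate`) — i.e. costume once Link A closed. v5 therefore RE-CUTS Link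
B in GENUINE (pinned-𝓛) currency over the tree's BDP frame `IsBDPLFunction`
(`Literature/NumberTheory/EllipticCurves/BDPAnticyclotomicPAdicLFunction.lean`; typing model = the
CGLS 2022 frames `CastellaGrossiLeeSkinner2022/IMC2DivisibilityAndBDPValueFrame.lean`), for the
newform `Dt.f` of E_n over a Heegner field K with 2 SPLIT, as THREE statements that DECOMPOSE
exactly the torsion half (log_ω y_K = 0 ⟹ 𝓛(𝟙) = 0 ⟹ F(0) = 0): stubs
**`stub_twoAdicBDPElementExists : TwoAdicBDPElementExists`** [XL, CONSTRUCTION at the supercuspidal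
prime 2, X11b H1 shape `∃ ι' inducing v ∧ ∃ Ω_K Ω_p 𝓛, IsBDPLFunction ι' v κ γ Dt.f Ω_K Ω_p 𝓛`; in
print only p ∤ N, p ≥ 5 (Castella–Hsieh 2018 Prop. 3.6) / p ∥ N (Castella 2018 Thm. 3.1)],
**`stub_twoAdicWanDivisibility : TwoAdicWanDivisibility`** [XL, THE research statement of the line:
the p-CONVERSE divisibility `2^k · j_*(char_Λ 𝔛) ⊆ (𝓛)` along every structure map j : ℤ₂ → R₀, for
EVERY BDP element of the frame (invariant under 𝓛 ↦ unit·𝓛; vacuous off the torsion locus) — the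
Skinner–Urban / X. Wan (Eisenstein-congruence) direction, NOT the Euler-system direction `p^k 𝓛 ∈
char · R₀⟦T⟧` of CGLS frame (i) `proofThm422_exists_isBDPLFunction_isTorsion_charIdeal_dvd`, which
is useless for a converse; no print at p = 2], **`stub_twoAdicBDPValueAtOne :
TwoAdicBDPValueAtOne`** [L–XL: `𝓛(𝟙) = u · c⁻² · (1 − a₂·2⁻¹ + [2 ∤ N]·2⁻¹)² · (padicLogOmega E_n 2
e P)²`, u ∈ R₀ˣ, general Euler factor kept (for E_n: a₂ = 0, 2 ∣ N), P THE Heegner point `w(P) =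
heegnerPointComplex Dt H`; shape of CGLS frame (ii) `thm513_exists_isBDPLFunction_valueAtOne` (p ∤
2N there); cf. Kriz–Li 2019 Thm. 1.16 `KrizLi2019/HeegnerLogCongruence.lean` at any prime (a
congruence, not this formula)], (the v5 plumbing stub `stub_heegnerNonTorsion_of_linkA_of_bdpTriple
(hKato) (hA : TwoAdicControlOfRankOne) (hE) (hWan) (hV) : HeegnerNonTorsionAtTwo` is LANDED p438932
and called by name — no longer a stub), `stub_textbookDualityImQuad` [M–L TEXTBOOK FACT `∀ K,
IsImaginaryQuadratic K → poitouTate_sum_localTatePairing_eq_zero K`, Milne ADT I 4.10(b)/2.3 — the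
ONE non-research input under Link A, now demanded only where Link A uses it; its `IsPerfect`
conjunct is automatic, p433586 `PoitouTateIsPerfect`, and the remaining global sum is ty g5's (F1)
supply map `HOME/bsd-cn100-ty/F1-SUPPLY-MAP-g5.md` rev 3, whose FIRST milestone «(F1) for totally
complex K» = F-a + F-c(light) + F-d closes this stub (claims on the bus 2026-08-26T11–12Z: ty g6
F-a, transfer-2 g4, s2b-c3 g4 prover side)] — CLOSED 2026-08-26 p455245, `stub_refereedInputs` [S,
CITATION-BORNE: the six refereed hypothesis types — 2-parity, modularity, Hoffstein–Luo, Kato,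
Heegner points, Gross–Zagier + Kolyvagin], rung `stub_rung_supersingular` [LANDED p410927; not
re-declared]. The three defs ARE landed (`Theorems/CongruentShaFreeCutTwoAdicBDPTriple.lean`,
p438932; namespace of record
`Summit.BirchSwinnertonDyer.BirchSwinnertonDyer.Theorems.CongruentShaFreeCutTwoAdicBDPTriple`).
SUPPORT LEMMAS LANDED — the p = 2 CHARACTER-SUPPLY PORT IS COMPLETE (transfer g8,
2026-08-26T11:36–11:40Z, `--supports stmt-BirchSwinnertonDyer-19080 --as helper`, 0 sorry, no def):
the frame's character supply / rigidity (`X11b.characterSupplyAt`, `X11b.isBDPLFunction_unique`,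
`X11b.isBDPLFunction_forall_of_exists`: «for EVERY BDP element» = «for SOME») were tree theorems for
ODD p only (`hp2 : p ≠ 2`); p441970 `CongruentShaFreeCutLambdaSupplyAllPrimes`
(`exists_lambda_pow_of_character`, `lambdaSupplyPowAt`: the anticyclotomic λ-supply of SOME positive
infinity type (m,−m) at EVERY prime, by squaring h := a/(a∘θ)) and p442134
`CongruentShaFreeCutCharacterSupply` (`exists_interpolationCharacter`, `characterSupplyAt`,
`exists_supply_tendsto`, `isBDPLFunction_unique`, `isBDPLFunction_forall_of_exists`,
`isBDPLFunctionInt_unique`, `isBDPLFunctionInt_forall_of_exists`, `twoAdic_isBDPLFunction_unique`,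
`twoAdic_isBDPLFunction_forall_of_exists`, `twoAdic_characterSupplyAt` — every prime, no `p ≠ 2`)
now CERTIFY in the tree that the ∀-forms of (LB-wan)/(LB-bdp) are not vacuous-by-emptiness of the
supply and let them be moved between BDP elements (plan g11's PORT NOTE
HOME/bsd-cn100-plan/routes-g11/kit/P2-CHARACTER-SUPPLY-PORT-NOTE.md executed; p442143
`…LambdaSupplyAnyPrime` of s2-c3 g5 is a harmless duplicate of p441970, not cited). NET: crux B =
(LB-exist) + (LB-wan) + (LB-bdp) + Poitou–Tate at imaginary quadratic K (textbook) + six refereed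
facts (plumbing PROVED, census p440516). Superseded (inactive) on 19080: `two-adic-bdp-triple` v5b
(3ecd44ad, 11:04Z: same with `stub_textbookDuality` at ∀ K), v5 (d5774449, 10:12Z: same statements
as skeleton-local defs + the plumbing stub, now landed), `two-adic-links` v4 (bc84199a, 08:08Z: Link
A binder stub `stub_twoAdicControlOfRankOne (hPT) (hEP)` — moot after p432373 — and Link B by name)
and v3 (437a9834). Documented alternative for B (inactive): `heegner-field-gz` (skeleton d981ef2b:
`stub_heegnerFieldData` [closed modulo facts p412976], `stub_twoConverseOverK` [XL; ≡ B modulo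
refereed facts — p417847, as are the ℚ-level `HeegnerNonTorsionAtTwo` cut p418170/p419056 and the
CLAIMED-conditional closures p418499; B with 2 ↦ any good p ≥ 5 is a tree theorem modulo BT20 +
BKO24, p418845: B is exactly the p = 2 column]). Promotion of the two links to route-level children
only when a hand is about to CLOSE one (director 2026-08-26T05:04Z; `route edit --split … --glue …
--glue-decl-name …`, never `--glue-by` a Theorems decl importing the route). LANDING CURRENCY
(read2-sk-3): the stubs' printed inputs (`p_parity`, Hoffstein–Luo, Kato, modularity) are tree
cite-facts, so the day-1 landable objects are binder-carrying support lemmas `facts →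
stub-statement` filed `--supports <item>` under their own names; the fact-free registered stubs stay
sorried until those facts are theorems.

SECOND ROAD OF RECORD for crux B (census, NOT a registered line; plan g13 RULING
2026-08-26T13:59:52Z): the KATO–ZETA / PERRIN-RIOU road of Burungale–Skinner ([ABS] arXiv:2210.10730
App. A Thm 10.1, Rem 10.5(i) «p = 2 allowed», Thm 10.6, §10.1.3) with Burungale–Tian, Ann. of Math.
203 (2026) Thm 2.6 (Kato's main conjecture in Λ⊗ℚ for every CM newform at every prime — REFEREED) —
tree: `Theorems/CongruentShaFreeCutKatoZetaRoad.lean` p448572 `cruxB_of_katoZetaRoad : (Kato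
finiteness) → (R: a Kato descent datum exists, PRINT 12.4/12.5/§14.14) → (3.1′: rank 1 ∧ Ш[p^∞]
finite ⟹ H²(ℤ[1/p],T) finite, PRINT (14.9.3)+(14.14.2)) → (K: Kato MC ⊗ℚ on every realised datum,
PRINT BT26 Thm 2.6) → (PR_p: Perrin-Riou's conjecture at the ADDITIVE prime, the ONE research
reading; [ABS] Thm 10.8 is printed only at good supersingular p, [ABS] §2 after Thm 2.10 names the
gap) → crux B`, over bsd-potss's interface `Rank1Residual.Additive.KatoDescentDatum p` with the
interface predicate IsOf FREE, and `cruxB_iff_perrinRiouReading_of_readings` (modulo the print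
readings crux B ⟺ PR_p). NUMBERS on that road: crux B = 3 PRINT readings + 1 fact + 1 OPEN
statement; the MAIN-CONJECTURE input is print, no Poitou–Tate over K, no anticyclotomic construction
or divisibility ((LB-exist)/(LB-wan) avoidable). Not registered because PR_p as typed is a
LOCALISATION of B (≡ B mod print) and the print stubs are not closable by name over a free IsOf;
definition items FILED by plan g13: `defn-IsKatoDescentDatumOf` (13:58Z; pins the datum to
bsd-smallim's `Kato2004.IwasawaH1Data`/`integralH1`, realisability fact shape ∃ D) and
`defn-HasLocPKummerLog` (14:14Z; «loc_p(x) ⊗ ℚ_p is a local Kummer class with formal-group logarithm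
t», Kummer-image currency of Bloch–Kato 1990 Ex. 3.11, log in the currency of
`Castella2018.padicLogOmega`, no B_cris/B_dR), both wanted by 19080 + 19160; REGISTRATION TRIGGER =
both definitions landed ∧ PR_p re-typed over the pinned zeta element as the FORMULA «log_BK(loc_p z)
= c·(log_ω P)², c ≠ 0» (strictly below B) + GZK (print) ⟹ line `kato-zeta-perrin-riou` v1 with stubs
{R, 3.1′, K, PRformula_p, GZK} on 19080.
CHEAPEST FALSIFIER. LMFDB/Magma lookup over square-free n ≤ 10⁴ with root number −1: any E_n with
2^∞-Selmer corank 1 (2-descent + Cassels–Tate pairing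
bound) whose analytic rank is certified 3 would kill crux B and the leaf. Known data (Elkies,
Watkins; congruent numbers to 10⁶ under BSD)
show no such n; not re-run here (compute discipline: lookup only).

NUMBERS. Smith 2022 (Smith2022SelmerTwistI Thm 1.2/1.3): among square-free n ≡ 5,6,7 (8), 100 % have
corank_{ℤ₂} Sel_{2^∞}(E_n) = 1; the leaf
turns this into r_an = rank = 1 for 100 % (tree:
`bsdRank_densityOne_congruentNumber_of_converse_of_smith2022`). Tian2014 (Thm 1.1/1.3: infinitely
many n in each class 5,6,7 (8) with any prescribed number of prime factors) and
TianYuanZhang2017 Thm 1.2 + Smith 2016 Thm 1.4/1.5 (a positive proportion in each class) —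
unconditional, genus-point method, inside S's known regime (LIT-G14 P2).
BKO 2024 Thm 1.5: p ≥ 5 inert; BKNO 2026: p ≥ 5 ramified, signed main conjectures, converse theorems
announced as future work (p. 8).
First rungs (BC5): crux B — its analogue for the SAME curves E_n at a good supersingular prime p ≥
7, p ≡ 3 (4), p ∤ n (a_p = 0) is the
tree theorem
`BurungaleKobayashiOta2024.analyticRank_eq_one_of_mordellWeilRank_eq_one_of_finite_sha_primary`
granted the printed fact
`thm15_…` (specialised to E_n, 0 sorries; registered stub `stub_rung_supersingular`, LANDED p410927
`…Theorems.CongruentShaFreeCutRungSupersingular.stub_rung_supersingular`), a regime where the leaf's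
analogue
(refined converse (1.6)) is open (Rem 1.6(ii)); crux A — LANDED SEPARATING rung
`stub_rung_monskyUncovered` (p418006 `…Theorems.CongruentShaFreeCutRungMonsky.rung_monskyUncovered`,
stub credit p419763): the crux
verbatim on the Monsky-uncovered family W = {2pq : p ≡ 3, q ≡ 5 (8) ∨ p ≡ 5, q ≡ 7 (8), (p/q) = −1}
modulo the ONE refereed fact Monsky, Math. Z. 204 (1990) Cor. 5.15 + Rem. (2)
(`Monsky1990.cor515_rank_eq_one_and_card_selmerGroup_two`; non-vacuous: corank = 1 holds on W),
where the leaf's conclusion ord_{s=1} L(E_{2pq}, s) = 1 is NOT in print (referee dossier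
GAP-LEDGER-read2-monsky-g29 §B; VERDICT IX-D §4(a)); tribunal identifiers
`…Theorems.CongruentShaFreeCutDefs.{rankPosOnMonskyUncovered_of_cor515,
AnalyticRankOneOnMonskyUncovered}` (p418186).
The Smith-class form (square-free n ≡ 5,6,7 (8), corank_{ℤ₂} Sel_{2^∞} = 1 ⇒ rank ≥ 1; genus Heegner
points of TianYuanZhang2017 + induction on ω(n)) stays an unregistered plan-only target, open as
stated.

DEFINITION REQUESTS. FILED 2026-08-26 (plan g13, for the kato-zeta / Perrin-Riou road of crux B;
ledger items, wanted by 19080 + 19160): `defn-IsKatoDescentDatumOf` (topic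
Literature/NumberTheory/EllipticCurves/Kato2004: pin bsd-potss's
`Rank1Residual.Additive.KatoDescentDatum p` to Kato's objects for T_pW over bsd-smallim's
`Kato2004.IwasawaH1Data`/`integralH1`/`IwasawaCohomologyEulerSystemLift` — D.H ≃ 𝐇¹(T)⁰, D.z ↦
z_γ^{(p)} with the p = 2 (12.5.2) caveat, D.H2 ≃ 𝐇²(T)⁰, D.A ≃ H¹(ℤ[1/p], j_*T), ι/π = (14.14.1)
[Kato, Astérisque 295, Thm 12.4 p.221, 12.5(4)+(12.5.2) p.222, §14.14 p.243]; plus the realisability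
fact shape ∃ D) and `defn-HasLocPKummerLog` (topic Literature/NumberTheory/EllipticCurves: loc_p of
a level-0 global class is a local Kummer class with prescribed formal-group logarithm [Bloch–Kato
1990 Def 3.10/Ex 3.11; Perrin-Riou 1993 §3.3; [ABS] arXiv:2210.10730 Thm 10.8 shape]). None at open.
Wanted later (informal workitems, not typed): anticyclotomic ℤ₂-tower Selmer/Λ-module for a CM curve
at a ramified prime;
Rubin/Katz-type two-variable 2-adic L-function for ℚ(i); "virtual Heegner class" (FanWan2023 §1.2).

Novelty: BC9 / ladder (render-head; full line + null queries in the body):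
method_family=anticyclotomic-iwasawa rubin-formula p-adic-waldspurger heegner-point gross-zagier
p-converse; ladder_ceiling=capped-at-GOOD-REDUCTION (ordinary: BCST 2022 Thm A; inert p ≥ 5: BKO
2024 Thm 1.5; supersingular incl. 2,3: Burungale–Skinner A.1, preprint — regimes detailed in the
body); ceiling_lift=a Rubin-type formula + explicit reciprocity law + anticyclotomic main conjecture
with control at a prime of ADDITIVE reduction (the ramified CM prime two) [declared-crux:
RankPosOfTwoSelmerCorankOne, AnalyticRankOneOfRankOneFiniteShaTwo];
ceiling_sources=[corpus:paper:arxiv-2608.06879 p.8,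
corpus:paper:burungale2025-rank-zero-p-converse-theorem-gross-zagier p.1-2, arXiv:2210.10730 App. A
Thm A.1, BurungaleKobayashiOta2023: Thm 1.5 + Rem 1.6(ii) (JIMJ 23 (2024) p.1422), Rubin1991: p ∤
#𝒪_K^× hypothesis].
Delta: the first typed decomposition of the ramified-prime rank-one 2-converse along the printed
Ш-freeness / Ш-finite cut, making BKO's Thm 1.5-shape statement at p = 2 for E_n a separately
claimable item whose inputs (Rubin-type formula, log non-vanishing any p, GZ) are closest to print.
Claimed grade: new-combination.
Nearest prior art (ids; detail below): Kriz2020 arXiv:2002.04767v5 Thm 10.13 (claims the leaf;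
unrefereed); FanWan2023 arXiv:2304.09806v2 Thm 1.1 [ThmM] ⟸ 4.2/4.4+5.18+6.9 (claims it; unrefereed;
cell-audited); BKO JIMJ 23 (2024) Thm 1.5 p.1422 (crux-B shape, inert p ≥ 5; refereed tree fact  [refs: 2210.10730, 2002.04767, 2304.09806, paper:arxiv-2608.06879, paper:burungale2025-rank-zero-p-converse-theorem-gross-zagier, BurungaleKobayashiOta2023, Rubin1991, Kriz2020, FanWan2023, BurungaleTian2026, BurungaleCastellaSkinnerTian2022]

Barriers (technique_class: anticyclotomic-iwasawa, rubin-formula, gross-zagier): - technique_class: anticyclotomic-iwasawa, rubin-formula, gross-zagier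
- Negatives index: `ledger negatives --problem BirchSwinnertonDyer` (2026-08-25, 1 entry):
stmt-BirchSwinnertonDyer-15532 (LeadingTermTamePinch: ∃ ordinary p ≥ 5 with a pinch condition,
refuted by LeadingTermTamePinch_refuted) — unrelated to E_n / p = 2; nothing steered around.
- Placement index (13 catalogued barriers; one detailed line each below, after this render-head):
SelmerRankBarrier — crux A INSIDE the Selmer→rank class but in the corank-ONE regime = the entry's
own evasions_known (point produced first by a Heegner/CM class), crux B outside; HeegnerPointBarrier
+ HeegnerPointBarrierNarrow — outside (both block only 2 ≤ analyticRank; corank 1 ⇒ sign −1 ⇒ r_an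
odd, B pins r_an = 1 by Gross–Zagier on the one Heegner/CM line); PAdicHeightBarrier +
AnticyclotomicHeightDegeneracy — outside (lever = (log_ω P)², a p-adic logarithm, ker log_ω =
torsion, AEC IV.6.4(b); no height/regulator; 2 is ADDITIVE for E_n); ExceptionalZeroBarrier — n/a
(additive, not split multiplicative); FunctionalEquationSeesOnlyParity +
PAdicFunctionalEquationSeesOnlyParity — outside (corank hypothesis + GZ, not a sign argument);
TwoDescentDefectUnbounded — outside (2^∞-Selmer CORANK, all levels);
DokchitserDokchitser2011_rankMod — n/a; NumericalVanishingBarrier — n/a;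
PlecticDeterminantVanishesOverQ — n/a (single class, r = 1); WeightHeightMinusHalfCyclotomic — n/a.
- Literature.Barriers.BirchSwinnertonDyer.SelmerRankBarrier: cru

sub-problem: BirchSwinnertonDyer · status: open · opened planner-bsd-cn100-plan-g6-0 2026-08-25T21:10:28Z · rev 23 · ledger route-BirchSwinnertonDyer-CongruentShaFreeCut
GENERATED by the gate from the ledger (D-0016/17). Provers cite these decls: `theorem foo : Summit.BirchSwinnertonDyer.BirchSwinnertonDyer.Theses.CongruentShaFreeCut.<Decl> := …` in Summits/BirchSwinnertonDyer/BirchSwinnertonDyer/Theorems/<Name>.lean.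
-/

namespace Summit.BirchSwinnertonDyer.BirchSwinnertonDyer.Theses.CongruentShaFreeCut

open scoped BigOperators Topology Manifold Classical MeasureTheory ProbabilityTheory Matrix InnerProductSpace ComplexConjugate ContinuousMap
open Filter Set Function TopologicalSpace MeasureTheory

attribute [summit_statement] _root_.BirchSwinnertonDyer
attribute [summit_statement] _root_.Literature.NumberTheory.EllipticCurves.rankOne_twoConverse_congruentNumber

open Literature

/-- item stmt-BirchSwinnertonDyer-19079 · crux · rank 2 · open · by planner
why it might fail: needs a CM main conjecture + control at p = 2 | #𝒪_K^× (Rubin1991 excludes p | w_K; BKNO 2026 ramified theory is p ≥ 5) and a non-torsion (virtual) Heegner class; Kriz2020 v5 Thm 10.13 / FanWan2023 v2 Thm 1.1 claim it, unrefereed, with cell-audited gaps at exactly this step.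
sources: Kriz2020, FanWan2023, BurungaleKobayashiNakamuraOta2026, Rubin1991, BurungaleKobayashiOta2023, Tian2014
[crux] Ш-freeness half at p = 2 for the congruent number family: for every n ≠ 0, if the 2^∞-Selmer
group of E_n/ℚ has ℤ₂-corank 1 then E_n(ℚ) has a point of infinite order (rank ≥ 1). Equivalent,
given corank 1, to «Ш(E_n/ℚ)[2^∞] is finite» (corank identity). [difficulty: open-problem] -/
@[route_item "route-BirchSwinnertonDyer-CongruentShaFreeCut", crux]
def RankPosOfTwoSelmerCorankOne : Prop :=
  ∀ ⦃n : ℕ⦄, n ≠ 0 → (Literature.NumberTheory.EllipticCurves.congruentNumberCurve n).selmerCorank 2 = 1 → 1 ≤ (Literature.NumberTheory.EllipticCurves.congruentNumberCurve n).mordellWeilRank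

/-- item stmt-BirchSwinnertonDyer-19080 · crux · rank 3 · open · by planner
why it might fail: In print the Ш-finite cut stops at GOOD reduction (ordinary: BCST22 Thm A; inert p ≥ 5: BKO24 Thm 1.5; supersingular incl. 2,3: Burungale–Skinner A.1 in arXiv:2210.10730, preprint); E_n is ADDITIVE at 2: no Rubin-type formula / ERL there in refereed print (FW v2 Thm 4.2/4.4+6.9 claim one).
sources: BurungaleKobayashiOta2023, FanWan2023, arXiv:2210.10730, BurungaleCastellaSkinnerTian2022, BertoliniDarmonPrasanna2013, Darmon2004
[crux] Ш-finite 2-converse for the congruent number family (BKO 2024 Thm 1.5 shape at the RAMIFIED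
prime 2): for every n ≠ 0, if rank E_n(ℚ) = 1 and Ш(E_n/ℚ)[2^∞] is finite then ord_{s=1} L(E_n, s) =
1. [difficulty: XL] -/
@[route_item "route-BirchSwinnertonDyer-CongruentShaFreeCut", crux]
def AnalyticRankOneOfRankOneFiniteShaTwo : Prop :=
  ∀ ⦃n : ℕ⦄, n ≠ 0 → (Literature.NumberTheory.EllipticCurves.congruentNumberCurve n).mordellWeilRank = 1 → Finite (AddCommGroup.primaryComponent (Literature.NumberTheory.EllipticCurves.congruentNumberCurve n).sha 2) → (Literature.NumberTheory.EllipticCurves.congruentNumberCurve n).analyticRank = 1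

/-- item stmt-BirchSwinnertonDyer-19081 · assembly · rank 1 · closed · proved by Summit.BirchSwinnertonDyer.BirchSwinnertonDyer.Theorems.CongruentShaFreeCutAssembly.assembly_holds @ ce3e7fc06eb8 (reviewer) · by planner
sources: Kriz2020, BurungaleKobayashiOta2023
[assembly] RankPosOfTwoSelmerCorankOne → AnalyticRankOneOfRankOneFiniteShaTwo → the rung-S2 leaf
rankOne_twoConverse_congruentNumber (provable now by the corank identity; proof recipe in the
Assembly paragraph). -/
@[route_item "route-BirchSwinnertonDyer-CongruentShaFreeCut", crux]
def Assembly : Prop :=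
  RankPosOfTwoSelmerCorankOne → AnalyticRankOneOfRankOneFiniteShaTwo → Literature.NumberTheory.EllipticCurves.rankOne_twoConverse_congruentNumber

-- `Assembly` holds: proved by `Summit.BirchSwinnertonDyer.BirchSwinnertonDyer.Theorems.CongruentShaFreeCutAssembly.assembly_holds` @ ce3e7fc06eb8 (its module imports this route file, so no `_holds` link can be stated here).

/-! D-0027 §2.1 — DECIDING THEOREM (planner-authored via `route open/edit --closes-file`; by planner-bsd-cn100-plan-g6-0 2026-08-25T21:10:29Z):
its hypotheses are this route's items and its conclusion the registered leaf `Literature.NumberTheory.EllipticCurves.rankOne_twoConverse_congruentNumber` (rung S2, D-0061) (glue_lint), and it elaborates with this file. -/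

@[closes "route-BirchSwinnertonDyer-CongruentShaFreeCut"] theorem closes (hA : RankPosOfTwoSelmerCorankOne) (hB : AnalyticRankOneOfRankOneFiniteShaTwo)
    (hAsm : Assembly) :
    Literature.NumberTheory.EllipticCurves.rankOne_twoConverse_congruentNumber :=
  hAsm hA hB

end Summit.BirchSwinnertonDyer.BirchSwinnertonDyer.Theses.CongruentShaFreeCut
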